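import Mathlib
import HarnessLib

/-!
# Markman 2025 — the IGUSA QUARTIC `J` on the half-spin representation `S⁺ = ∧^{ev} H¹(X)` of an abelian
# threefold ([M] §10.1, formula (10.1.1)) and its PRINTED EVALUATIONS (Lemma 10.1.1 (proof), Remark 10.1.2 (1),
# Lemma 10.2.1 (proof), Examples 10.2.2–10.2.3), with the exterior-algebra sign bookkeeping of `e*_ij` and of
# `Θ = e₁∧e₄ + e₂∧e₅ + e₃∧e₆` — AS PRINTED, kernel-checked

E. Markman: [M] *Cycles on abelian 2n-folds of Weil type from secant sheaves on abelian n-folds*,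
arXiv:2502.03415 **v2** (2025-06-08), bib `Markman2025SecantWeil` — UNREFEREED PREPRINT. Pages/lines = PyMuPDF lines
of the public v2 PDF (sha256/16 `8155aa33870069b8`), read at seat lit-w-markman g15 (pub-hsemireg LIT-W, 2026-08-23;
sheet `LOCATOR-SHEET-MARKMAN.md` §45), BY EYE on 160-dpi renders `HOME/lit/Markman-renders-litw-markman-g15/`
`r_mar25_v2_p89_sec101_eq1011.png`, `…p89_L1011_proof_Jw.png`, `…p90_R1012.png`, `…p90_sec102_L1021.png`,
`…p91_Ex1022_Ex1023.png`, `…p52_alpha_beta.png`. [M] p. 88 L42–44: «We provide a more conceptual construction of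
secant sheaves using results of Igusa. The results of this section are not used in the paper.»

## What is printed (verbatim, v2)
* §10.1, p. 89 L3–14: «Let `X` be an abelian 3-fold, so that `V` has rank 12. The group `Spin(V)` acts naturally on
  the coordinate polynomial ring `Sym((S⁺_ℚ)^*)` of the half-spin representation `S⁺_ℚ`. The ring
  `Sym((S⁺_ℚ)^*)^{Spin(V)}` of invariant polynomials is generated by a single polynomial `J` of degree 4, by
  [I, Prop. 3]. …»
* p. 89 L15–44: «We recall next the explicit formula for Igusa's quartic. Let `{e₁, …, e₆}` be a basis of `H¹(X, ℤ)`
  with `∫_X e₁ ∧ e₂ ∧ ⋯ ∧ e₆ = 1`. Set `[pt_X] := e₁ ∧ e₂ ∧ ⋯ ∧ e₆`. For `1 ≤ i < j ≤ 6`, set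
  `e*_ij := (−1)^{i+j−1} e₁ ∧ ⋯ ∧ e_{i−1} ∧ e_{i+1} ∧ ⋯ ∧ e_{j−1} ∧ e_{j+1} ∧ ⋯ ∧ e₆`, so that
  `e_i ∧ e_j ∧ e*_ij = [pt_X]`. Given an alternating matrix `A` of rank `2r`, denote by `Pf(A)` the Pfaffian of `A`
  normalized so that `Pf((0 I_r; −I_r 0)) = 1`, where `I_r` is the `r × r` identity matrix. An element `x ∈ S⁺_ℚ` is
  a linear combination `x = x₀ + Σ_{i<j} x_ij e_i ∧ e_j + Σ_{i<j} y_ij e*_ij + y₀[pt_X]` with rational coefficients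
  `x₀, x_ij, y_ij`, and `y₀`. Let `X_ij` be the matrix obtained from `(x_ij)` by crossing out the `i`-th and `j`-th
  rows and columns. Define `Y_ij` similarly in terms of `(y_ij)`. Then the Igusa quartic is
  (10.1.1) `J(x) = x₀Pf((y_ij)) + y₀Pf((x_ij)) + Σ_{i<j} Pf(X_ij)Pf(Y_ij) − (1/4)(x₀y₀ − Σ_{i<j} x_ij y_ij)²,`
  [I, Prop. 3].»
* Lemma 10.1.1, proof, p. 89 L81–84: «Let `w = 1 + d[pt_X]`, `d ≠ 0`, … Then `w` belongs to the plane spanned by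
  the two pure spinors `1` and `[pt_X]` and `J(w) = −(1/4)d²`.»
* REMARK 10.1.2 (1), p. 90 L23–29: «For any subfield `F` of `ℂ`, the level set `J^{−1}(d) ⊂ S⁺_F`, `d ∈ F`, consists
  of a single `Spin(V_F)`-orbit, by [I, Prop. 3]. Furthermore, if `w = 1 + e*₁₄ + e*₂₅ + de*₃₆`, `d ∈ F`, then
  `J(w) = d`.»
* §10.2, p. 90 L35–39: «If `w` belongs to `S⁺_ℚ`, then `d := J(w)` is a rational number, since `J` is defined over
  `ℚ`. Set `K := ℚ[√−d]`. Assume that `−d` is not a square of a rational number.»; LEMMA 10.2.1 (p. 90 L46–52): «Let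
  `w ∈ S⁺_ℚ` be a rational class with `d := J(w) > 0`. Set `K := ℚ[√−d]`. Then the two maximal isotropic subspaces
  `W₁` and `W₂` of `V_ℂ` invariant under `Spin(V_ℚ)_w` are defined over `K`, but not over `ℚ`, and `σ(W₁) = W₂`. …»;
  proof, p. 90 L53–55: «There exists an element `g ∈ Spin(V_K)`, such that `g(w) = 1 + 2√−d[pt_X]`, by the last
  paragraph in the proof of [I, Prop. 3].»
* EXAMPLE 10.2.2, p. 91 L17–40: «… Gulbrandsen proves the non-emptiness of the moduli space `M(2, 0, dΘ²)` of
  slope-stable vector bundles `F` of rank 2 with `c₁(F) = 0` and `c₂(F) = dΘ²`, for every positive integer `d`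
  [G, Theorem 2.3]. … The Chern character of a vector bundle `F` in `M(2, 0, dΘ²)` is `w := 2 − dΘ²`. We claim
  that `J(w) = 16d³`, so that `K = ℚ(√−d)`. Indeed, there is a basis `{e₁, e₂, …, e₆}` of `H¹(X, ℤ)`, such that
  `Θ = e₁ ∧ e₄ + e₂ ∧ e₅ + e₃ ∧ e₆`. So
  `Θ² = 2 [e₁ ∧ e₄ ∧ e₂ ∧ e₅ + e₁ ∧ e₄ ∧ e₃ ∧ e₆ + e₂ ∧ e₅ ∧ e₃ ∧ e₆] = (−2)(e*₃₆ + e*₂₅ + e*₁₄),`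
  and `w = 2 + 2d(e*₃₆ + e*₂₅ + e*₁₄)`, so `J(w) = 2⁴d³J(1 + (e*₃₆ + e*₂₅ + e*₁₄)) = 16d³`. Note that `w = 2α`,
  where `α` is the class in Lemma 8.2.1.» — with `α := 1 − (d/2)Θ²` (p. 52 L3).
* EXAMPLE 10.2.3, p. 91 L41–43: «The Igusa invariant of the Chern character of the ideal sheaf of a length `n` zero
  dimensional subscheme is `J(1 − n[pt_X]) = −(1/4)n² = −(n/2)²`, and so `K = ℚ`» (sic, no full stop).

## What this file proves (0 named facts, 0 sorry; the `def`s are MODELS with bodies)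
§A — COORDINATES. `Coord K` = the printed coordinate vector `(x₀, (x_ij)_{i<j}, (y_ij)_{i<j}, y₀)` of an element of
`S⁺` (only the entries `1 ≤ i < j ≤ 6` of `x`, `y : ℕ → ℕ → K` are ever read; `coord_count`: `1 + 15 + 15 + 1 = 32 =
2⁵`); `pf6` / `pf4` = the Pfaffians of a `6 × 6` / `4 × 4` alternating matrix in MARKMAN'S NORMALISATION (the
textbook 15-term / 3-term expansions carry the sign `(−1)^{r(r−1)/2}` on `(0 I_r; −I_r 0)`, so the printed
normalisation flips both: `pf6_normalisation`, `pf4_normalisation`, and `pf6_textbook_std` records the textbook value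
`−1`); `pfMinor a i j = Pf(A_ij)` («crossing out the `i`-th and `j`-th rows and columns», the 15-row table in its
body); `J` = (10.1.1) term by term. EVALUATIONS, each a kernel-checked identity in any field `K`:
`J_one_add_pt` (`J(1 + d[pt_X]) = −(1/4)d²`, Lemma 10.1.1 proof), `J_remark_10_1_2` (`J(1 + e*₁₄ + e*₂₅ + d e*₃₆) =
d`), `J_lemma_10_2_1_normal_form` (`J(1 + 2√−d[pt_X]) = d` whenever `s² = −d` — consistent with `J(w) = d` and the
single-orbit statement), `J_smul` (`J(t x) = t⁴J(x)`, the homogeneity behind «`2⁴`»), `J_example_10_2_2` (`J(2 +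
2d(e*₃₆ + e*₂₅ + e*₁₄)) = 16d³`) with `J_example_10_2_2_display` (`= 2⁴d³·J(1 + (e*₃₆ + e*₂₅ + e*₁₄))` and
`J(1 + (e*₃₆ + e*₂₅ + e*₁₄)) = 1`), `neg_J_example_10_2_2_square_class` (`−16d³ = (4d)²·(−d)` — «so that
`K = ℚ(√−d)`»), `J_example_10_2_3` (`J(1 − n[pt_X]) = −(1/4)n² = −(n/2)²`, so `−J` is a square — «`K = ℚ`»).
§B — SIGNS IN `∧H¹(X)`. In ANY ring `A` with six elements `ε₁, …, ε₆` satisfying `ε_i² = 0` and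
`ε_iε_j + ε_jε_i = 0` (e.g. `ε_i = ι(e_i)` in Mathlib's `ExteriorAlgebra R M`, `exterior_relations`): `vol =
ε₁⋯ε₆` (`[pt_X]`), `eHat i j` = the increasing product omitting `i, j` (15-row table), `eStar i j = (−1)^{i+j−1}·eHat i j`
AS PRINTED; `e_mul_e_mul_eStar` («so that `e_i ∧ e_j ∧ e*_ij = [pt_X]`», all 15 pairs); `theta = ε₁ε₄ + ε₂ε₅ +
ε₃ε₆`; `theta_sq_first` / `theta_sq` (the two printed equalities for `Θ²`), `two_sub_smul_theta_sq` («`w = 2 +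
2d(e*₃₆ + e*₂₅ + e*₁₄)`» for `w = 2 − dΘ²`), `two_mul_alpha` («`w = 2α`», `α = 1 − (d/2)Θ²`, needs `2 ≠ 0` in `K`).
§C — A READING PRECISION (P-10.2.2, this seat ×1; it does NOT change any printed value): in the printed basis of
Example 10.2.2 one has `Θ³ = −6·e₁∧⋯∧e₆` (`theta_cube`: the word `e₁e₄e₂e₅e₃e₆` has three inversions), so with
`[pt_X] := e₁∧⋯∧e₆` (p. 89) that basis has `∫_X Θ³ = −6 ∫_X [pt_X]`, whereas `Θ³ = 3!·deg = 6` for a principal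
polarisation forces `∫_X e₁∧⋯∧e₆ = −1` there, against p. 89's normalisation `= 1`. Re-ordering `f₁ := e₄, f₄ := e₁`
(`reorient`) restores `Θ³ = +6·f₁∧⋯∧f₆` (`theta_cube_reorient`) and gives `Θ² = 2(f*₃₆ + f*₂₅ − f*₁₄)`
(`theta_sq_reorient`), i.e. coordinates `(x₀; y₁₄, y₂₅, y₃₆) = (2; 2d, −2d, −2d)` for `w`, and (10.1.1) returns the
SAME value `J(w) = 2·y₁₄y₂₅y₃₆ = 16d³` (`J_example_10_2_2_reorient`). So the printed `J(w) = 16d³` and «`K = ℚ(√−d)`»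
stand under either orientation.
BY VALUE (printed inputs, not modelled): [I, Prop. 3] (`J` generates the invariants; level sets are single orbits),
the tangential-variety statement, Lemma 10.1.1 itself, Gulbrandsen's theorems, `ch(F) = 2 − dΘ²` for `F ∈ M(2, 0, dΘ²)`
(`c₃ = 0` for rank 2), and the identification of the coordinates of §A with the basis `{1, e_ie_j, e*_ij, [pt_X]}` of
`∧^{ev}` used to pass from §B to §A (a basis statement; Mathlib's `Module.Basis.ExteriorAlgebra` would supply it).
Nothing in this file says that HC / HC_CM / HC_AV is proved or that any object is semiregular or hyperholomorphic.
-/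

namespace Literature.AlgebraicGeometry.Markman2025.IgusaQuartic

/-! ### §A. Coordinates on `S⁺` and the Igusa quartic (10.1.1) -/

section Coordinates

variable {K : Type*} [Field K]

/-- p. 89 L3 «`X` … an abelian 3-fold, so that `V` has rank 12» and the coordinate count of p. 89 L32–41: `S⁺ = ∧⁰ ⊕ ∧² ⊕
∧⁴ ⊕ ∧⁶` of a rank-`6` lattice has `1 + 15 + 15 + 1 = 32 = 2⁵` coordinates `x₀, x_ij, y_ij, y₀` (half of `2⁶`).
[cite: Markman2025SecantWeil, §10.1, p. 89 L3–41] -/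
theorem coord_count : 1 + Nat.choose 6 2 + Nat.choose 6 4 + 1 = 32 ∧ (32 : ℕ) = 2 ^ (6 - 1) ∧ 2 * 32 = 2 ^ 6 := by
  decide

/-- The printed coordinate vector of «an element `x ∈ S⁺_ℚ` … `x = x₀ + Σ_{i<j} x_ij e_i ∧ e_j + Σ_{i<j} y_ij e*_ij +
y₀[pt_X]`» (p. 89 L32–41): `x0`, the upper entries `x i j` (`1 ≤ i < j ≤ 6`; other arguments are never read) of the
alternating matrix `(x_ij)`, likewise `y i j`, and `y0`. A MODEL (coefficients only; the basis is by value).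
[cite: Markman2025SecantWeil, §10.1, p. 89 L32–41] -/
structure Coord (K : Type*) where
  /-- coefficient of `1 ∈ ∧⁰` -/
  x0 : K
  /-- coefficient of `e_i ∧ e_j`, read only for `1 ≤ i < j ≤ 6` -/
  x : ℕ → ℕ → K
  /-- coefficient of `e*_ij`, read only for `1 ≤ i < j ≤ 6` -/
  y : ℕ → ℕ → K
  /-- coefficient of `[pt_X] = e₁ ∧ ⋯ ∧ e₆` -/
  y0 : K

namespace Coord

/-- sum of coordinate vectors -/
instance : Add (Coord K) := ⟨fun a b => ⟨a.x0 + b.x0, a.x + b.x, a.y + b.y, a.y0 + b.y0⟩⟩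
/-- difference of coordinate vectors -/
instance : Sub (Coord K) := ⟨fun a b => ⟨a.x0 - b.x0, a.x - b.x, a.y - b.y, a.y0 - b.y0⟩⟩
/-- scalars -/
instance : SMul K (Coord K) := ⟨fun t a => ⟨t * a.x0, t • a.x, t • a.y, t * a.y0⟩⟩

/-- projection of a sum (plumbing). [folklore] -/
@[simp] private theorem add_x0 (a b : Coord K) : (a + b).x0 = a.x0 + b.x0 := rfl
/-- projection of a sum (plumbing). [folklore] -/
@[simp] private theorem add_x (a b : Coord K) : (a + b).x = a.x + b.x := rfl
/-- projection of a sum (plumbing). [folklore] -/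
@[simp] private theorem add_y (a b : Coord K) : (a + b).y = a.y + b.y := rfl
/-- projection of a sum (plumbing). [folklore] -/
@[simp] private theorem add_y0 (a b : Coord K) : (a + b).y0 = a.y0 + b.y0 := rfl
/-- projection of a difference (plumbing). [folklore] -/
@[simp] private theorem sub_x0 (a b : Coord K) : (a - b).x0 = a.x0 - b.x0 := rfl
/-- projection of a difference (plumbing). [folklore] -/
@[simp] private theorem sub_x (a b : Coord K) : (a - b).x = a.x - b.x := rfl
/-- projection of a difference (plumbing). [folklore] -/
@[simp] private theorem sub_y (a b : Coord K) : (a - b).y = a.y - b.y := rfl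
/-- projection of a difference (plumbing). [folklore] -/
@[simp] private theorem sub_y0 (a b : Coord K) : (a - b).y0 = a.y0 - b.y0 := rfl
/-- projection of a scalar multiple (plumbing). [folklore] -/
@[simp] private theorem smul_x0 (t : K) (a : Coord K) : (t • a).x0 = t * a.x0 := rfl
/-- projection of a scalar multiple (plumbing). [folklore] -/
@[simp] private theorem smul_x (t : K) (a : Coord K) : (t • a).x = t • a.x := rfl
/-- projection of a scalar multiple (plumbing). [folklore] -/
@[simp] private theorem smul_y (t : K) (a : Coord K) : (t • a).y = t • a.y := rfl
/-- projection of a scalar multiple (plumbing). [folklore] -/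
@[simp] private theorem smul_y0 (t : K) (a : Coord K) : (t • a).y0 = t * a.y0 := rfl

/-- `1 ∈ H⁰(X, ℤ) ⊂ S⁺` («`1 ∈ H⁰(X, ℤ)` is an even pure spinor», p. 52 L25–26): `x₀ = 1`, all else `0`.
[cite: Markman2025SecantWeil, §10.1, p. 89 L32–41] -/
def one : Coord K := ⟨1, 0, 0, 0⟩

/-- «`[pt_X] := e₁ ∧ e₂ ∧ ⋯ ∧ e₆`»: `y₀ = 1`, all else `0`. [cite: Markman2025SecantWeil, §10.1, p. 89 L18] -/
def pt : Coord K := ⟨0, 0, 0, 1⟩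

/-- the basis vector `e*_ij` of `∧⁴` as a coordinate vector: `y_ij = 1`, all else `0`.
[cite: Markman2025SecantWeil, §10.1, p. 89 L19–21 / L32–41] -/
def eStar (i j : ℕ) : Coord K := ⟨0, 0, fun p q => if p = i ∧ q = j then 1 else 0, 0⟩

/-- unfolding `one` (plumbing). [folklore] -/
@[simp] private theorem one_x0 : (one : Coord K).x0 = 1 := rfl
/-- unfolding `one` (plumbing). [folklore] -/
@[simp] private theorem one_x : (one : Coord K).x = 0 := rfl
/-- unfolding `one` (plumbing). [folklore] -/
@[simp] private theorem one_y : (one : Coord K).y = 0 := rfl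
/-- unfolding `one` (plumbing). [folklore] -/
@[simp] private theorem one_y0 : (one : Coord K).y0 = 0 := rfl
/-- unfolding `pt` (plumbing). [folklore] -/
@[simp] private theorem pt_x0 : (pt : Coord K).x0 = 0 := rfl
/-- unfolding `pt` (plumbing). [folklore] -/
@[simp] private theorem pt_x : (pt : Coord K).x = 0 := rfl
/-- unfolding `pt` (plumbing). [folklore] -/
@[simp] private theorem pt_y : (pt : Coord K).y = 0 := rfl
/-- unfolding `pt` (plumbing). [folklore] -/
@[simp] private theorem pt_y0 : (pt : Coord K).y0 = 1 := rfl
/-- unfolding `eStar` (plumbing). [folklore] -/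
@[simp] private theorem eStar_x0 (i j : ℕ) : (eStar i j : Coord K).x0 = 0 := rfl
/-- unfolding `eStar` (plumbing). [folklore] -/
@[simp] private theorem eStar_x (i j : ℕ) : (eStar i j : Coord K).x = 0 := rfl
/-- unfolding `eStar` (plumbing). [folklore] -/
@[simp] private theorem eStar_y (i j : ℕ) :
    (eStar i j : Coord K).y = fun p q => if p = i ∧ q = j then 1 else 0 := rfl
/-- unfolding `eStar` (plumbing). [folklore] -/
@[simp] private theorem eStar_y0 (i j : ℕ) : (eStar i j : Coord K).y0 = 0 := rfl

end Coord

/-- The Pfaffian of the `4 × 4` alternating matrix with upper entries `a p q, a p r, a p s, a q r, a q s, a r s` on the rows/columns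
`p < q < r < s`, in MARKMAN'S NORMALISATION «`Pf((0 I_r; −I_r 0)) = 1`» (p. 89 L23–31): the textbook expansion
`a_pq a_rs − a_pr a_qs + a_ps a_qr` takes the value `−1` on `(0 I₂; −I₂ 0)` (only `a₁₃ = a₂₄ = 1`), so the printed
normalisation is its NEGATIVE (`pf4_normalisation`). [cite: Markman2025SecantWeil, §10.1, p. 89 L23–31] -/
def pf4 (a : ℕ → ℕ → K) (p q r s : ℕ) : K :=
  -(a p q * a r s - a p r * a q s + a p s * a q r)

/-- The Pfaffian of the `6 × 6` alternating matrix `(a_ij)` (upper entries `a i j`, `1 ≤ i < j ≤ 6`), in MARKMAN'S NORMALISATION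
(p. 89 L23–31): the NEGATIVE of the textbook 15-term expansion along the first row (which takes the value
`(−1)^{3·2/2} = −1` on `(0 I₃; −I₃ 0)`, `pf6_textbook_std`; `pf6_normalisation`).
[cite: Markman2025SecantWeil, §10.1, p. 89 L23–31] -/
def pf6 (a : ℕ → ℕ → K) : K :=
  -(a 1 2 * (a 3 4 * a 5 6 - a 3 5 * a 4 6 + a 3 6 * a 4 5)
    - a 1 3 * (a 2 4 * a 5 6 - a 2 5 * a 4 6 + a 2 6 * a 4 5)
    + a 1 4 * (a 2 3 * a 5 6 - a 2 5 * a 3 6 + a 2 6 * a 3 5)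
    - a 1 5 * (a 2 3 * a 4 6 - a 2 4 * a 3 6 + a 2 6 * a 3 4)
    + a 1 6 * (a 2 3 * a 4 5 - a 2 4 * a 3 5 + a 2 5 * a 3 4))

/-- The upper entries of the standard alternating matrix `(0 I₃; −I₃ 0)` on indices `1 … 6`: `a₁₄ = a₂₅ = a₃₆ = 1`.
[cite: Markman2025SecantWeil, §10.1, p. 89 L23–31] -/
def stdForm3 : ℕ → ℕ → K := fun i j => if (i = 1 ∧ j = 4) ∨ (i = 2 ∧ j = 5) ∨ (i = 3 ∧ j = 6) then 1 else 0

/-- The upper entries of `(0 I₂; −I₂ 0)` on indices `1 … 4`: `a₁₃ = a₂₄ = 1`. [cite: Markman2025SecantWeil, §10.1, p. 89 L23–31] -/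
def stdForm2 : ℕ → ℕ → K := fun i j => if (i = 1 ∧ j = 3) ∨ (i = 2 ∧ j = 4) then 1 else 0

/-- «normalized so that `Pf((0 I_r; −I_r 0)) = 1`», `r = 3`. [cite: Markman2025SecantWeil, §10.1, p. 89 L23–31] -/
theorem pf6_normalisation : pf6 (stdForm3 : ℕ → ℕ → K) = 1 := by
  simp [pf6, stdForm3]

/-- The textbook expansion (the bracket negated in `pf6`) takes the value `−1 = (−1)^{r(r−1)/2}`, `r = 3`, on `(0 I₃; −I₃ 0)` —
the reason for the sign in `pf6`. [cite: Markman2025SecantWeil, §10.1, p. 89 L23–31] -/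
theorem pf6_textbook_std : -pf6 (stdForm3 : ℕ → ℕ → K) = -1 ∧ ((-1 : ℤ) ^ (3 * (3 - 1) / 2) = -1) := by
  refine ⟨by rw [pf6_normalisation], by decide⟩

/-- «normalized so that `Pf((0 I_r; −I_r 0)) = 1`», `r = 2`. [cite: Markman2025SecantWeil, §10.1, p. 89 L23–31] -/
theorem pf4_normalisation : pf4 (stdForm2 : ℕ → ℕ → K) 1 2 3 4 = 1 := by
  simp [pf4, stdForm2]

/-- `Pf(A_ij)`: «Let `X_ij` be the matrix obtained from `(x_ij)` by crossing out the `i`-th and `j`-th rows and columns»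
(p. 89 L42–43) — the normalised `4 × 4` Pfaffian on the complementary indices, listed pair by pair; `0` off the 15
pairs `1 ≤ i < j ≤ 6`. [cite: Markman2025SecantWeil, §10.1, p. 89 L42–44] -/
def pfMinor (a : ℕ → ℕ → K) : ℕ → ℕ → K
  | 1, 2 => pf4 a 3 4 5 6
  | 1, 3 => pf4 a 2 4 5 6
  | 1, 4 => pf4 a 2 3 5 6
  | 1, 5 => pf4 a 2 3 4 6
  | 1, 6 => pf4 a 2 3 4 5
  | 2, 3 => pf4 a 1 4 5 6
  | 2, 4 => pf4 a 1 3 5 6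
  | 2, 5 => pf4 a 1 3 4 6
  | 2, 6 => pf4 a 1 3 4 5
  | 3, 4 => pf4 a 1 2 5 6
  | 3, 5 => pf4 a 1 2 4 6
  | 3, 6 => pf4 a 1 2 4 5
  | 4, 5 => pf4 a 1 2 3 6
  | 4, 6 => pf4 a 1 2 3 5
  | 5, 6 => pf4 a 1 2 3 4
  | _, _ => 0

/-- «`Σ_{i<j}`» over the 15 pairs `1 ≤ i < j ≤ 6` of (10.1.1), written out. [cite: Markman2025SecantWeil, §10.1 (10.1.1), p. 89 L45–53] -/
def sum15 (f : ℕ → ℕ → K) : K :=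
  f 1 2 + f 1 3 + f 1 4 + f 1 5 + f 1 6 + f 2 3 + f 2 4 + f 2 5 + f 2 6 + f 3 4 + f 3 5 + f 3 6 + f 4 5 + f 4 6
    + f 5 6

/-- THE IGUSA QUARTIC, formula (10.1.1) AS PRINTED:
«`J(x) = x₀Pf((y_ij)) + y₀Pf((x_ij)) + Σ_{i<j} Pf(X_ij)Pf(Y_ij) − (1/4)(x₀y₀ − Σ_{i<j} x_ij y_ij)²`».
[cite: Markman2025SecantWeil, §10.1 (10.1.1), p. 89 L44–53] -/
def J (w : Coord K) : K :=
  w.x0 * pf6 w.y + w.y0 * pf6 w.x + sum15 (fun i j => pfMinor w.x i j * pfMinor w.y i j)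
    - (1 / 4) * (w.x0 * w.y0 - sum15 (fun i j => w.x i j * w.y i j)) ^ 2

/-- the minors of the zero matrix vanish (plumbing). [folklore] -/
@[simp] private theorem pfMinor_zero (i j : ℕ) : pfMinor (0 : ℕ → ℕ → K) i j = 0 := by
  unfold pfMinor; split <;> simp [pf4]

/-- the Pfaffian of the zero matrix vanishes (plumbing). [folklore] -/
@[simp] private theorem pf6_zero : pf6 (0 : ℕ → ℕ → K) = 0 := by
  simp [pf6]

/-- `Pf` of a `6 × 6` matrix is cubic in the entries (plumbing for `J_smul`). [folklore] -/
private theorem pf6_smul (t : K) (a : ℕ → ℕ → K) : pf6 (t • a) = t ^ 3 * pf6 a := by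
  simp only [pf6, Pi.smul_apply, smul_eq_mul]; ring

/-- `Pf` of a `4 × 4` matrix is quadratic in the entries (plumbing for `J_smul`). [folklore] -/
private theorem pf4_smul (t : K) (a : ℕ → ℕ → K) (p q r s : ℕ) : pf4 (t • a) p q r s = t ^ 2 * pf4 a p q r s := by
  simp only [pf4, Pi.smul_apply, smul_eq_mul]; ring

/-- the minors are quadratic in the entries (plumbing for `J_smul`). [folklore] -/
private theorem pfMinor_smul (t : K) (a : ℕ → ℕ → K) (i j : ℕ) : pfMinor (t • a) i j = t ^ 2 * pfMinor a i j := by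
  unfold pfMinor; split <;> simp [pf4_smul]

/-- `J` is a QUARTIC form: `J(t·x) = t⁴J(x)` — the homogeneity used in «`J(w) = 2⁴d³J(1 + …)`» (p. 91 L36).
[cite: Markman2025SecantWeil, Example 10.2.2, p. 91 L36 (with (10.1.1), p. 89)] -/
theorem J_smul (t : K) (w : Coord K) : J (t • w) = t ^ 4 * J w := by
  simp [J, pf6_smul, pfMinor_smul, sum15]
  ring

/-- Lemma 10.1.1, proof: «Let `w = 1 + d[pt_X]`, `d ≠ 0`, … and `J(w) = −(1/4)d²`.»
[cite: Markman2025SecantWeil, Lemma 10.1.1 (proof), p. 89 L81–84] -/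
theorem J_one_add_pt (d : K) : J (Coord.one + d • Coord.pt) = -(1 / 4) * d ^ 2 := by
  simp [J, sum15, pf6]

/-- REMARK 10.1.2 (1): «if `w = 1 + e*₁₄ + e*₂₅ + de*₃₆`, `d ∈ F`, then `J(w) = d`.» (Only the term `x₀Pf((y_ij))` survives, and
`Pf` in the printed normalisation of the matrix with `y₁₄ = y₂₅ = 1`, `y₃₆ = d` is `d`.)
[cite: Markman2025SecantWeil, Remark 10.1.2 (1), p. 90 L25–29] -/
theorem J_remark_10_1_2 (d : K) : J (Coord.one + Coord.eStar 1 4 + Coord.eStar 2 5 + d • Coord.eStar 3 6) = d := by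
  simp [J, sum15, pf6]

/-- Lemma 10.2.1, proof: «There exists an element `g ∈ Spin(V_K)`, such that `g(w) = 1 + 2√−d[pt_X]`» — and indeed
`J(1 + 2s[pt_X]) = −(1/4)(2s)² = d` whenever `s² = −d`, consistent with `J(w) = d` and the `Spin`-invariance of `J`
(Remark 10.1.2 (1): «the level set `J^{−1}(d)` … consists of a single `Spin(V_F)`-orbit»; invariance itself is BY VALUE).
[cite: Markman2025SecantWeil, Lemma 10.2.1 (proof), p. 90 L53–55] -/
theorem J_lemma_10_2_1_normal_form [CharZero K] (d s : K) (hs : s ^ 2 = -d) :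
    J (Coord.one + (2 * s) • Coord.pt) = d := by
  rw [J_one_add_pt]
  linear_combination (-1 : K) * hs

/-- EXAMPLE 10.2.2: «`w = 2 + 2d(e*₃₆ + e*₂₅ + e*₁₄)`, so `J(w) = … = 16d³`.»
[cite: Markman2025SecantWeil, Example 10.2.2, p. 91 L33–39] -/
theorem J_example_10_2_2 (d : K) :
    J ((2 : K) • Coord.one + (2 * d) • (Coord.eStar 3 6 + Coord.eStar 2 5 + Coord.eStar 1 4)) = 16 * d ^ 3 := by
  simp [J, sum15, pf6]
  ring

/-- EXAMPLE 10.2.2, the displayed intermediate step: «`J(w) = 2⁴d³J(1 + (e*₃₆ + e*₂₅ + e*₁₄)) = 16d³`» — the value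
`J(1 + (e*₃₆ + e*₂₅ + e*₁₄)) = 1` is Remark 10.1.2 (1) at `d = 1`.
[cite: Markman2025SecantWeil, Example 10.2.2, p. 91 L36–39] -/
theorem J_example_10_2_2_display (d : K) :
    J ((2 : K) • Coord.one + (2 * d) • (Coord.eStar 3 6 + Coord.eStar 2 5 + Coord.eStar 1 4))
        = 2 ^ 4 * d ^ 3 * J (Coord.one + (Coord.eStar 3 6 + Coord.eStar 2 5 + Coord.eStar 1 4))
      ∧ J (Coord.one + (Coord.eStar 3 6 + Coord.eStar 2 5 + Coord.eStar 1 4) : Coord K) = 1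
      ∧ (2 : K) ^ 4 * d ^ 3 * 1 = 16 * d ^ 3 := by
  have h1 : J (Coord.one + (Coord.eStar 3 6 + Coord.eStar 2 5 + Coord.eStar 1 4) : Coord K) = 1 := by
    simp [J, sum15, pf6]
  refine ⟨?_, h1, by ring⟩
  rw [J_example_10_2_2, h1]; ring

/-- EXAMPLE 10.2.2: «`J(w) = 16d³`, so that `K = ℚ(√−d)`» — with `K := ℚ[√(−J(w))]` (§10.2, p. 90 L35–37): `−16d³` and `−d`
differ by the square `(4d)²`, so they generate the same quadratic field for `d ≠ 0`.
[cite: Markman2025SecantWeil, Example 10.2.2, p. 91 L24–25] -/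
theorem neg_J_example_10_2_2_square_class (d : K) : -(16 * d ^ 3) = (4 * d) ^ 2 * (-d) := by
  ring

/-- EXAMPLE 10.2.3: «`J(1 − n[pt_X]) = −(1/4)n² = −(n/2)²`, and so `K = ℚ`» (`−J` is the square `(n/2)²`).
[cite: Markman2025SecantWeil, Example 10.2.3, p. 91 L41–43] -/
theorem J_example_10_2_3 [CharZero K] (n : K) :
    J (Coord.one - n • Coord.pt) = -(1 / 4) * n ^ 2 ∧ -(1 / 4) * n ^ 2 = -(n / 2) ^ 2
      ∧ -J (Coord.one - n • Coord.pt) = (n / 2) ^ 2 := by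
  have h : J (Coord.one - n • Coord.pt) = -(1 / 4) * n ^ 2 := by simp [J, sum15, pf6]
  refine ⟨h, by ring, by rw [h]; ring⟩

/-- §C (reading precision P-10.2.2, see the module docstring): in the RE-ORIENTED basis `f₁ := e₄, f₄ := e₁` of Example 10.2.2
(`theta_sq_reorient`: `Θ² = 2(f*₃₆ + f*₂₅ − f*₁₄)`) the coordinates of `w = 2 − dΘ²` are `(x₀; y₁₄, y₂₅, y₃₆) =
(2; 2d, −2d, −2d)`, and (10.1.1) gives the SAME value `16d³`. [cite: Markman2025SecantWeil, Example 10.2.2, p. 91 L27–39] -/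
theorem J_example_10_2_2_reorient (d : K) :
    J ((2 : K) • Coord.one + (2 * d) • Coord.eStar 1 4 - (2 * d) • Coord.eStar 2 5 - (2 * d) • Coord.eStar 3 6)
      = 16 * d ^ 3 := by
  simp [J, sum15, pf6]
  ring

end Coordinates

/-! ### §B. The signs of `e*_ij` and of `Θ²` in the exterior algebra (any ring with anticommuting square-zero `ε₁, …, ε₆`) -/

section Wedge

variable {A : Type*} [Ring A] (ε : ℕ → A)

/-- The relations `ε_i² = 0`, `ε_iε_j + ε_jε_i = 0` hold for `ε_i := ι(v_i)` in Mathlib's exterior algebra `∧_R M` of ANY module, for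
any vectors `v_i` — in particular for a basis `e₁, …, e₆` of `H¹(X, ℤ)` and the wedge products of p. 89 L15–22 (Mathlib:
`ExteriorAlgebra.ι_sq_zero`, `ExteriorAlgebra.ι_add_mul_swap`). [cite: Markman2025SecantWeil, §10.1, p. 89 L15–22] -/
theorem exterior_relations {R M : Type*} [CommRing R] [AddCommGroup M] [Module R M] (v : ℕ → M) :
    (∀ i, ExteriorAlgebra.ι R (v i) * ExteriorAlgebra.ι R (v i) = 0) ∧
      (∀ i j, ExteriorAlgebra.ι R (v i) * ExteriorAlgebra.ι R (v j)
        + ExteriorAlgebra.ι R (v j) * ExteriorAlgebra.ι R (v i) = 0) :=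
  ⟨fun i => ExteriorAlgebra.ι_sq_zero (v i), fun i j => ExteriorAlgebra.ι_add_mul_swap (v i) (v j)⟩

/-- `[pt_X] := e₁ ∧ e₂ ∧ ⋯ ∧ e₆` (p. 89 L18). [cite: Markman2025SecantWeil, §10.1, p. 89 L15–18] -/
def vol : A := ε 1 * ε 2 * ε 3 * ε 4 * ε 5 * ε 6

/-- `e₁ ∧ ⋯ ∧ e_{i−1} ∧ e_{i+1} ∧ ⋯ ∧ e_{j−1} ∧ e_{j+1} ∧ ⋯ ∧ e₆` — the increasing product OMITTING `i` and `j`, pair by pair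
(`0` off the 15 pairs). [cite: Markman2025SecantWeil, §10.1, p. 89 L19–21] -/
def eHat (ε : ℕ → A) : ℕ → ℕ → A
  | 1, 2 => ε 3 * ε 4 * ε 5 * ε 6
  | 1, 3 => ε 2 * ε 4 * ε 5 * ε 6
  | 1, 4 => ε 2 * ε 3 * ε 5 * ε 6
  | 1, 5 => ε 2 * ε 3 * ε 4 * ε 6
  | 1, 6 => ε 2 * ε 3 * ε 4 * ε 5
  | 2, 3 => ε 1 * ε 4 * ε 5 * ε 6
  | 2, 4 => ε 1 * ε 3 * ε 5 * ε 6
  | 2, 5 => ε 1 * ε 3 * ε 4 * ε 6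
  | 2, 6 => ε 1 * ε 3 * ε 4 * ε 5
  | 3, 4 => ε 1 * ε 2 * ε 5 * ε 6
  | 3, 5 => ε 1 * ε 2 * ε 4 * ε 6
  | 3, 6 => ε 1 * ε 2 * ε 4 * ε 5
  | 4, 5 => ε 1 * ε 2 * ε 3 * ε 6
  | 4, 6 => ε 1 * ε 2 * ε 3 * ε 5
  | 5, 6 => ε 1 * ε 2 * ε 3 * ε 4
  | _, _ => 0

/-- «`e*_ij := (−1)^{i+j−1} e₁ ∧ ⋯ ∧ e_{i−1} ∧ e_{i+1} ∧ ⋯ ∧ e_{j−1} ∧ e_{j+1} ∧ ⋯ ∧ e₆`» AS PRINTED.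
[cite: Markman2025SecantWeil, §10.1, p. 89 L19–21] -/
def eStar (i j : ℕ) : A := (-1) ^ (i + j - 1) * eHat ε i j

/-- «`Θ = e₁ ∧ e₄ + e₂ ∧ e₅ + e₃ ∧ e₆`» (the basis of Example 10.2.2). [cite: Markman2025SecantWeil, Example 10.2.2, p. 91 L27–28] -/
def theta : A := ε 1 * ε 4 + ε 2 * ε 5 + ε 3 * ε 6

/-- «For `1 ≤ i < j ≤ 6`»: the 15 pairs. [cite: Markman2025SecantWeil, §10.1, p. 89 L18] -/
def pairs6 : List (ℕ × ℕ) :=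
  [(1, 2), (1, 3), (1, 4), (1, 5), (1, 6), (2, 3), (2, 4), (2, 5), (2, 6), (3, 4), (3, 5), (3, 6), (4, 5), (4, 6),
    (5, 6)]

/-- sorting step (bare pair): for `i < j`, `ε_j ε_i = −ε_i ε_j` (helper). [folklore] -/
private theorem sort_pair (hanti : ∀ i j, ε i * ε j + ε j * ε i = 0) {i j : ℕ} (_h : i < j) :
    ε j * ε i = -(ε i * ε j) :=
  eq_neg_of_add_eq_zero_right (hanti i j)

/-- sorting step inside a right-associated word (helper). [folklore] -/
private theorem sort_pair_assoc (hanti : ∀ i j, ε i * ε j + ε j * ε i = 0) {i j : ℕ} (_h : i < j) (x : A) :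
    ε j * (ε i * x) = -(ε i * (ε j * x)) := by
  rw [← mul_assoc, sort_pair ε hanti _h, neg_mul, mul_assoc]

/-- a repeated letter kills a right-associated word (helper). [folklore] -/
private theorem sq_assoc (hsq : ∀ i, ε i * ε i = 0) (i : ℕ) (x : A) : ε i * (ε i * x) = 0 := by
  rw [← mul_assoc, hsq i, zero_mul]

/-- «so that `e_i ∧ e_j ∧ e*_ij = [pt_X]`» — for ALL fifteen pairs `1 ≤ i < j ≤ 6`, from anticommutation alone.
[cite: Markman2025SecantWeil, §10.1, p. 89 L19–22] -/
theorem e_mul_e_mul_eStar (hanti : ∀ i j, ε i * ε j + ε j * ε i = 0) :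
    ∀ p ∈ pairs6, ε p.1 * ε p.2 * eStar ε p.1 p.2 = vol ε := by
  intro p hp
  simp only [pairs6, List.mem_cons, List.mem_nil_iff, or_false] at hp
  rcases hp with rfl | rfl | rfl | rfl | rfl | rfl | rfl | rfl | rfl | rfl | rfl | rfl | rfl | rfl | rfl <;>
    simp [eStar, eHat, vol, mul_assoc, sort_pair ε hanti, sort_pair_assoc ε hanti, pow_succ]

/-- EXAMPLE 10.2.2, first printed equality: «`Θ² = 2 [e₁ ∧ e₄ ∧ e₂ ∧ e₅ + e₁ ∧ e₄ ∧ e₃ ∧ e₆ + e₂ ∧ e₅ ∧ e₃ ∧ e₆]`».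
[cite: Markman2025SecantWeil, Example 10.2.2, p. 91 L29] -/
theorem theta_sq_first (hsq : ∀ i, ε i * ε i = 0) (hanti : ∀ i j, ε i * ε j + ε j * ε i = 0) :
    theta ε ^ 2 = 2 * (ε 1 * ε 4 * ε 2 * ε 5 + ε 1 * ε 4 * ε 3 * ε 6 + ε 2 * ε 5 * ε 3 * ε 6) := by
  simp [theta, sq, mul_add, add_mul, mul_assoc, sort_pair ε hanti, sort_pair_assoc ε hanti, hsq]
  noncomm_ring

/-- EXAMPLE 10.2.2, second printed equality: «`Θ² = … = (−2)(e*₃₆ + e*₂₅ + e*₁₄)`» (with `e*_ij` AS PRINTED, signs included).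
[cite: Markman2025SecantWeil, Example 10.2.2, p. 91 L29–32] -/
theorem theta_sq (hsq : ∀ i, ε i * ε i = 0) (hanti : ∀ i j, ε i * ε j + ε j * ε i = 0) :
    theta ε ^ 2 = (-2) * (eStar ε 3 6 + eStar ε 2 5 + eStar ε 1 4) := by
  simp [theta, eStar, eHat, mul_add, add_mul, mul_assoc, sort_pair ε hanti, sort_pair_assoc ε hanti, hsq, pow_succ]
  noncomm_ring

/-- EXAMPLE 10.2.2: «`w := 2 − dΘ²` … and `w = 2 + 2d(e*₃₆ + e*₂₅ + e*₁₄)`» — in any `R`-algebra `A` carrying the `ε_i`.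
[cite: Markman2025SecantWeil, Example 10.2.2, p. 91 L24 / L33–36] -/
theorem two_sub_smul_theta_sq {R : Type*} [CommRing R] [Algebra R A] (hsq : ∀ i, ε i * ε i = 0)
    (hanti : ∀ i j, ε i * ε j + ε j * ε i = 0) (d : R) :
    (2 : A) - d • theta ε ^ 2 = 2 + (2 * d) • (eStar ε 3 6 + eStar ε 2 5 + eStar ε 1 4) := by
  rw [theta_sq ε hsq hanti, neg_mul, smul_neg, sub_neg_eq_add, ← mul_smul_comm, two_mul, mul_smul, two_smul]

/-- EXAMPLE 10.2.2: «Note that `w = 2α`, where `α` is the class in Lemma 8.2.1» — `α := 1 − (d/2)Θ²` (p. 52 L3): `2(1 − (d/2)Θ²) =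
2 − dΘ²` over any field with `2 ≠ 0`. [cite: Markman2025SecantWeil, Example 10.2.2, p. 91 L39–40 / p. 52 L3] -/
theorem two_mul_alpha {K : Type*} [Field K] [Algebra K A] (h2 : (2 : K) ≠ 0) (d : K) :
    (2 : A) * (1 - (d / 2) • theta ε ^ 2) = 2 - d • theta ε ^ 2 := by
  rw [mul_sub, mul_one, Algebra.smul_def, Algebra.smul_def, ← mul_assoc]
  congr 2
  rw [show (2 : A) = algebraMap K A 2 from (map_ofNat (algebraMap K A) 2).symm, ← map_mul,
    mul_div_cancel₀ d h2]

/-! ### §C. Reading precision P-10.2.2: the orientation of the basis in Example 10.2.2 -/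

/-- In the PRINTED basis of Example 10.2.2, `Θ³ = 6·(e₁e₄)(e₂e₅)(e₃e₆) = −6·e₁e₂e₃e₄e₅e₆` (the word `e₁e₄e₂e₅e₃e₆` has three
inversions): with `[pt_X] := e₁ ∧ ⋯ ∧ e₆` (p. 89 L18) this reads `Θ³ = −6[pt_X]`. A reading note of this seat, not a printed
statement; it does not affect any printed value (`J_example_10_2_2_reorient`).
[cite: Markman2025SecantWeil, Example 10.2.2, p. 91 L27–28 / §10.1, p. 89 L15–18] -/
theorem theta_cube (hsq : ∀ i, ε i * ε i = 0) (hanti : ∀ i j, ε i * ε j + ε j * ε i = 0) :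
    theta ε ^ 3 = (-6) * vol ε := by
  simp [theta, vol, pow_succ, mul_add, add_mul, mul_assoc, sort_pair ε hanti, sort_pair_assoc ε hanti, hsq,
    sq_assoc ε hsq]
  noncomm_ring

/-- The re-oriented family `f₁ := e₄`, `f₄ := e₁`, `f_k := e_k` otherwise (this seat's device for reading precision P-10.2.2;
not a printed object). [folklore] -/
def reorient (ε : ℕ → A) : ℕ → A := fun k => if k = 1 then ε 4 else if k = 4 then ε 1 else ε k

/-- In the re-oriented basis, `Θ = −f₁f₄ + f₂f₅ + f₃f₆`. [cite: Markman2025SecantWeil, Example 10.2.2, p. 91 L27–28] -/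
theorem theta_reorient (hanti : ∀ i j, ε i * ε j + ε j * ε i = 0) :
    theta ε = -(reorient ε 1 * reorient ε 4) + reorient ε 2 * reorient ε 5 + reorient ε 3 * reorient ε 6 := by
  simp [theta, reorient, sort_pair ε hanti]

/-- … so `Θ² = 2(f*₃₆ + f*₂₅ − f*₁₄)`: the coordinates of `w = 2 − dΘ²` become `(y₁₄, y₂₅, y₃₆) = (2d, −2d, −2d)`
(`J_example_10_2_2_reorient`). [cite: Markman2025SecantWeil, Example 10.2.2, p. 91 L29–36] -/
theorem theta_sq_reorient (hsq : ∀ i, ε i * ε i = 0) (hanti : ∀ i j, ε i * ε j + ε j * ε i = 0) :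
    theta ε ^ 2 = 2 * (eStar (reorient ε) 3 6 + eStar (reorient ε) 2 5 - eStar (reorient ε) 1 4) := by
  simp [theta, eStar, eHat, reorient, mul_add, add_mul, mul_sub, mul_assoc, sort_pair ε hanti,
    sort_pair_assoc ε hanti, hsq, pow_succ]
  noncomm_ring

/-- … and `Θ³ = +6·f₁f₂f₃f₄f₅f₆`: the re-oriented basis is the one normalised as on p. 89 (`∫_X f₁∧⋯∧f₆ = 1`) when `∫_X Θ³ = 6`.
[cite: Markman2025SecantWeil, Example 10.2.2, p. 91 L27–28 / §10.1, p. 89 L15–18] -/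
theorem theta_cube_reorient (hsq : ∀ i, ε i * ε i = 0) (hanti : ∀ i j, ε i * ε j + ε j * ε i = 0) :
    theta ε ^ 3 = 6 * vol (reorient ε) := by
  simp [theta, vol, reorient, pow_succ, mul_add, add_mul, mul_assoc, sort_pair ε hanti, sort_pair_assoc ε hanti,
    hsq, sq_assoc ε hsq]
  noncomm_ring

/-- Non-vacuity of §B's hypotheses in the intended model: for `ε_i := ι(v_i)` in `∧_R M` the printed identity for `Θ²` holds
as an equation in the exterior algebra. [cite: Markman2025SecantWeil, Example 10.2.2, p. 91 L29–32] -/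
theorem theta_sq_exterior {R M : Type*} [CommRing R] [AddCommGroup M] [Module R M] (v : ℕ → M) :
    theta (fun i => ExteriorAlgebra.ι R (v i)) ^ 2
      = (-2) * (eStar (fun i => ExteriorAlgebra.ι R (v i)) 3 6 + eStar (fun i => ExteriorAlgebra.ι R (v i)) 2 5
          + eStar (fun i => ExteriorAlgebra.ι R (v i)) 1 4) :=
  theta_sq _ (exterior_relations v).1 (exterior_relations v).2

end Wedge

/-! ## §D (APPEND, lit-w-markman g15, 2026-08-23) — REMARK 10.1.2 (2): the secant `ℙ(P_w)` of Lemma 10.1.1 meets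
## the quartic `V(J)` in the two pure spinors `1`, `[pt_X]`, each with multiplicity 2, and `1`, `[pt_X]` are singular points of `V(J)`

v2 p. 90 L30–34, BY EYE on the 160-dpi render `HOME/lit/Markman-renders-litw-markman-g15/r_mar25_v2_p90_rem1012.png`
(sha256/16 `fee2189cad175bb8`): «(2) Note that the secant `ℙ(P_w)` to the spinor variety in Lemma 10.1.1 intersects the
quartic `V(J)` along the same two points along which it intersected the spinor variety, each with multiplicity 2,
since the even spinor variety is contained in the singular locus of `V(J)`. The subspace `P_w` is defined over `ℚ`,
and so the length two subscheme of the intersection of `ℙ(P_w)` with the spinor variety is defined over `ℚ`.»  With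
the proof of Lemma 10.1.1 (p. 89 L80–84: «it suffices to prove the statement for one such `w ∈ S⁺_ℂ` in each fiber.
Let `w = 1 + d[pt_X]`, `d ≠ 0`, … Then `w` belongs to the plane spanned by the two pure spinors `1` and `[pt_X]` and
`J(w) = −(1/4)d²`», p. 90 L11–12: «the line `ℙ(span{1, [pt_X]})` is the unique line secant to the spinor variety and
passing through `w`»): `P_w = span{1, [pt_X]}`.  KERNEL (coordinates of §A, any field `K`): `J_secant_one_pt` — on the
secant line, `J(s·1 + t·[pt_X]) = −(1/4)(st)²`, a DOUBLE root at each of `[1 : 0] = [1]` and `[0 : 1] = [[pt_X]]`, and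
(`J_secant_eq_zero_iff`, `4 ≠ 0` in `K`) no other zero on the line; `J_near_one` / `J_near_pt` — for EVERY direction
`v ∈ S⁺`, `J(1 + εv)` and `J([pt_X] + εv)` equal `ε²·(explicit polynomial in ε)`, i.e. `J` vanishes to order `≥ 2`
at `1` and at `[pt_X]` along every line through them: both pure spinors are SINGULAR points of `V(J)` («the even
spinor variety is contained in the singular locus of `V(J)`», checked at these two points; that all even pure spinors
form one `Spin(V)`-orbit on which `J` is invariant is [I, Prop. 3] / [Ch] BY VALUE, as is «`P_w` is defined over `ℚ`»).
The `ε⁴`-coefficient in both expansions is `J(v)` itself (homogeneity, cf. `J_smul`). No named fact; nothing geometric.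
-/

section Remark1012part2

variable {K : Type*} [Field K]

/-- REMARK 10.1.2 (2), the secant line of Lemma 10.1.1 (`P_w = span{1, [pt_X]}`): «intersects the quartic `V(J)` along
the same two points along which it intersected the spinor variety, each with multiplicity 2» — in coordinates,
`J(s·1 + t·[pt_X]) = −(1/4)(st)²` (double root at `s = 0` and at `t = 0`).
[cite: Markman2025SecantWeil, Remark 10.1.2 (2), p. 90 L30–33] -/
theorem J_secant_one_pt (s t : K) : J (s • Coord.one + t • Coord.pt) = -(1 / 4) * (s * t) ^ 2 := by
  simp [J, sum15, pf6, mul_pow]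

/-- … and these are the ONLY two points of `ℙ(P_w) ∩ V(J)`: for `4 ≠ 0` in `K`, `J(s·1 + t·[pt_X]) = 0 ↔ s = 0 ∨ t = 0`.
[cite: Markman2025SecantWeil, Remark 10.1.2 (2), p. 90 L30–33] -/
theorem J_secant_eq_zero_iff (h4 : (4 : K) ≠ 0) (s t : K) :
    J (s • (Coord.one : Coord K) + t • Coord.pt) = 0 ↔ s = 0 ∨ t = 0 := by
  rw [J_secant_one_pt]
  constructor
  · intro h
    have e : (s * t) ^ 2 = -(4 : K) * (-(1 / 4) * (s * t) ^ 2) := by field_simp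
    rw [h, mul_zero] at e
    exact mul_eq_zero.mp (pow_eq_zero_iff two_ne_zero |>.mp e)
  · rintro (h | h) <;> simp [h]

/-- REMARK 10.1.2 (2): «since the even spinor variety is contained in the singular locus of `V(J)`» — checked at the
pure spinor `1`: for every direction `v`, `J(1 + εv) = ε²·(−(1/4)v_{y₀}² + ε(Pf((v_{y,ij})) − (1/4)·2v_{y₀}(v_{x₀}v_{y₀} −
Σ_{i<j} v_{x,ij}v_{y,ij})) + ε²J(v))` (the `(1/4)·2` is the cross term of the printed square, kept unreduced so that the
identity holds in every characteristic) — no constant and no linear term in `ε`, so `1` is a singular point of `V(J)`.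
[cite: Markman2025SecantWeil, Remark 10.1.2 (2), p. 90 L32–33] -/
theorem J_near_one (ε : K) (v : Coord K) :
    J (Coord.one + ε • v) = ε ^ 2 * (-(1 / 4) * v.y0 ^ 2
      + ε * (pf6 v.y - (1 / 4) * (2 * v.y0 * (v.x0 * v.y0 - sum15 (fun i j => v.x i j * v.y i j))))
      + ε ^ 2 * J v) := by
  have hx0 : (Coord.one + ε • v).x0 = 1 + ε * v.x0 := rfl
  have hx : (Coord.one + ε • v).x = ε • v.x := by funext i j; simp
  have hy : (Coord.one + ε • v).y = ε • v.y := by funext i j; simp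
  have hy0 : (Coord.one + ε • v).y0 = ε * v.y0 := by simp
  have hxy : (sum15 fun i j => (ε • v.x) i j * (ε • v.y) i j) = ε ^ 2 * sum15 fun i j => v.x i j * v.y i j := by
    simp only [sum15, Pi.smul_apply, smul_eq_mul]; ring
  have hmm : (sum15 fun i j => pfMinor (ε • v.x) i j * pfMinor (ε • v.y) i j)
      = ε ^ 4 * sum15 fun i j => pfMinor v.x i j * pfMinor v.y i j := by
    simp only [sum15, pfMinor_smul]; ring
  unfold J
  rw [hx0, hx, hy, hy0, hxy, hmm, pf6_smul, pf6_smul]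
  ring

/-- Symmetrically at the pure spinor `[pt_X]`: `J([pt_X] + εv) = ε²·(−(1/4)v_{x₀}² + ε(Pf((v_{x,ij})) −
(1/4)·2v_{x₀}(v_{x₀}v_{y₀} − Σ_{i<j} v_{x,ij}v_{y,ij})) + ε²J(v))`, so `[pt_X]` is a singular point of `V(J)` too.
[cite: Markman2025SecantWeil, Remark 10.1.2 (2), p. 90 L32–33] -/
theorem J_near_pt (ε : K) (v : Coord K) :
    J (Coord.pt + ε • v) = ε ^ 2 * (-(1 / 4) * v.x0 ^ 2
      + ε * (pf6 v.x - (1 / 4) * (2 * v.x0 * (v.x0 * v.y0 - sum15 (fun i j => v.x i j * v.y i j))))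
      + ε ^ 2 * J v) := by
  have hx0 : (Coord.pt + ε • v).x0 = ε * v.x0 := by simp
  have hx : (Coord.pt + ε • v).x = ε • v.x := by funext i j; simp
  have hy : (Coord.pt + ε • v).y = ε • v.y := by funext i j; simp
  have hy0 : (Coord.pt + ε • v).y0 = 1 + ε * v.y0 := rfl
  have hxy : (sum15 fun i j => (ε • v.x) i j * (ε • v.y) i j) = ε ^ 2 * sum15 fun i j => v.x i j * v.y i j := by
    simp only [sum15, Pi.smul_apply, smul_eq_mul]; ring
  have hmm : (sum15 fun i j => pfMinor (ε • v.x) i j * pfMinor (ε • v.y) i j)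
      = ε ^ 4 * sum15 fun i j => pfMinor v.x i j * pfMinor v.y i j := by
    simp only [sum15, pfMinor_smul]; ring
  unfold J
  rw [hx0, hx, hy, hy0, hxy, hmm, pf6_smul, pf6_smul]
  ring

end Remark1012part2

end Literature.AlgebraicGeometry.Markman2025.IgusaQuartic
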